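import Summits.Ventures.CertifiedArithmetic.LowPrec.SRDoubleRounding
import Summits.Ventures.CertifiedArithmetic.LowPrec.SRFormatsBridge
import Summits.Ventures.CertifiedArithmetic.LowPrec.SRSpacing
import Summits.Ventures.CertifiedArithmetic.LowPrec.EmbeddingDecision
import HarnessLib

/-!
# Double stochastic rounding on minifloat formats = the conversion lattice (file XLI)

HONEST FRAMING: certified error envelopes and provably optimal rounding/accumulation schemes for
low-precision formats under stated cost models; every table by two implementations; no hardware or
vendor claims.

File XL (`SRDoubleRounding`) proved over any finite set: SR into an intermediate `G` followed by
SR into the target `F` has the law of one SR into `F`, for every input, iff `F ⊆ G` (targets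
with two elements).  Here `F = F_φ`, `G = F_ψ` are the value sets of two minifloat formats:

* `embeds_iff_subset` — the enumeration seat's `Embeds φ ψ` (every `φ`-value is a `ψ`-value)
  is value-set inclusion; `doubleSR_iff_embeds` — **for ANY two formats, double SR `ψ` then `φ`
  equals single SR into `φ` in law for every rational input iff `Embeds φ ψ`** (a degenerate
  one-value format embeds everywhere; no other hypothesis, saturation included).
* `doubleSR_named_iff` — with the decision procedure of `EmbeddingDecision`: over the 13 named
  formats the innocuous (target, intermediate) pairs are EXACTLY the 67 pairs of the conversion
  lattice `embedPairs`.  Instances: every SR pipeline ending in FP4 is innocuous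
  (`doubleSR_E2M1_via_E3M2`; three stages `tripleSR_E2M1_via_E4M3_via_Binary32`); E3M2 via
  E2M3 is not (`doubleSR_E3M2_via_E2M3`), with the kernel's
  explicit witness on the literal FP6 tables at `c = 1/16 ∈ F_E3M2 ∖ F_E2M3`
  (`doubleSR_E3M2_via_E2M3_witness`: single SR is exact there, the composite puts mass `1/2`
  on `0` and `1/2` on `1/8`, variance `1/256` — unbiased but not the same rounding;
  `step_step_id`: without the embedding the composite keeps the right mean wherever neither
  step saturates).
-/

namespace Summit.Ventures.CertifiedArithmetic.LowPrec.SR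

open Literature.ComputerArithmetic.ConnollyHighamMary2021
open Literature.ComputerArithmetic.FloatingPoint
open Finset
open Literature.ComputerArithmetic.FloatingPoint.MiniFloat

section Generic

variable {K : Type*} [Field K] [LinearOrder K] [IsStrictOrderedRing K]

omit [IsStrictOrderedRing K] in
/-- Without the embedding the composite is still UNBIASED wherever neither step saturates
(`E[SR_F(SR_G(c))] = c` if `c` is in the hull of `G` and both `G`-candidates are in the hull of
`F`) — it is then a different, wider rounding with the right mean (cf. the E3M2-via-E2M3 witness
below: mean `1/16`, variance `1/256` instead of `0`). -/
theorem step_step_id {F G : Finset K} {c : K} (hG : InHull G c) (hd : InHull F (dn G c))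
    (hu : InHull F (up G c)) : step G c (fun y => step F y fun t => t) = c := by
  rw [step_congr G c (g := fun y => y) (by rw [step_id, clamp_eq_self hu])
    (by rw [step_id, clamp_eq_self hd]), step_id, clamp_eq_self hG]

end Generic

/-- `Embeds φ ψ` is value-set inclusion. -/
theorem embeds_iff_subset (φ ψ : Format) : Embeds φ ψ ↔ valueSet φ ⊆ valueSet ψ := by
  constructor
  · intro h v hv
    obtain ⟨x, hx⟩ := mem_valueSet.mp hv
    obtain ⟨z, hz⟩ := h x
    exact mem_valueSet.mpr ⟨z, hz.trans hx⟩
  · intro h x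
    obtain ⟨z, hz⟩ := mem_valueSet.mp (h (toRat_mem_valueSet x))
    exact ⟨z, hz⟩

/-- `0 ∈ F_φ` (local copy). -/
private theorem zero_mem (φ : Format) : (0 : ℚ) ∈ valueSet φ := by
  simpa using toRat_mem_valueSet (MiniFloat.zero φ)

/-- **DOUBLE SR ON FORMATS.** For ANY two minifloat formats `φ` (target) and `ψ` (intermediate):
SR into `ψ` followed by SR into `φ` has, for every rational input and every test function, the
expectation of one SR into `φ` — the same law, saturation included — iff `F_φ ⊆ F_ψ`
(`Embeds φ ψ`).  (A degenerate one-value format embeds everywhere and is innocuous trivially.)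
[new] -/
theorem doubleSR_iff_embeds (φ ψ : Format) :
    (∀ (c : ℚ) (f : ℚ → ℚ), step (valueSet ψ) c (fun y => step (valueSet φ) y f) =
      step (valueSet φ) c f) ↔ Embeds φ ψ := by
  rw [embeds_iff_subset]
  have hF := valueSet_nonempty φ
  by_cases hab : (valueSet φ).min' hF < (valueSet φ).max' hF
  · exact step_step_iff_subset hF hab (valueSet_nonempty ψ)
  · -- one-value format: `F_φ = {0}`
    push Not at hab
    have h0 : ∀ v ∈ valueSet φ, v = 0 := by
      intro v hv
      have h1 := (valueSet φ).min'_le v hv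
      have h2 := (valueSet φ).le_max' v hv
      have h3 := (valueSet φ).min'_le 0 (zero_mem φ)
      have h4 := (valueSet φ).le_max' 0 (zero_mem φ)
      linarith
    have hsub : valueSet φ ⊆ valueSet ψ := fun v hv => by rw [h0 v hv]; exact zero_mem ψ
    exact ⟨fun _ => hsub, fun _ c f => step_step_of_subset hF hsub c f⟩

/-- **THE NAMED TABLE** (with the enumeration seat's decision procedure `EmbeddingDecision`):
over the 13 named formats, double SR `Y` then `X` is innocuous exactly on the 67 pairs `(X, Y)`
of the conversion lattice `embedPairs` (54 strict), e.g. FP4 through anything; E3M2 through E4M3,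
E5M2 and four P3109 formats but not through E2M3 or binary8p5; every FP8/P3109 format through
binary16, bfloat16, binary32; binary16 NOT through bfloat16 nor conversely. -/
theorem doubleSR_named_iff {X Y : Format} (hX : X ∈ namedFormats) (hY : Y ∈ namedFormats) :
    (∀ (c : ℚ) (f : ℚ → ℚ), step (valueSet Y) c (fun y => step (valueSet X) y f) =
      step (valueSet X) c f) ↔ (X, Y) ∈ embedPairs :=
  (doubleSR_iff_embeds X Y).trans (embeds_named_iff hX hY)

/-- Example, innocuous: an SR pipeline `… → E3M2 → E2M1` ending in FP4 equals direct SR to FP4,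
in law, for every rational input. -/
theorem doubleSR_E2M1_via_E3M2 (c : ℚ) (f : ℚ → ℚ) :
    step (valueSet Format.E3M2) c (fun y => step (valueSet Format.E2M1) y f) =
      step (valueSet Format.E2M1) c f :=
  (doubleSR_named_iff (by decide) (by decide)).mpr (by decide) c f

/-- Example, a three-stage pipeline: SR into binary32, then SR into E4M3, then SR into E2M1 has
the law of ONE stochastic rounding into E2M1, for every rational input (two applications of the
lattice: `E2M1 ↪ E4M3`, `E2M1 ↪ binary32`). -/
theorem tripleSR_E2M1_via_E4M3_via_Binary32 (c : ℚ) (f : ℚ → ℚ) :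
    step (valueSet Format.Binary32) c (fun z => step (valueSet Format.E4M3) z
      fun y => step (valueSet Format.E2M1) y f) = step (valueSet Format.E2M1) c f := by
  have h1 : ∀ z, step (valueSet Format.E4M3) z (fun y => step (valueSet Format.E2M1) y f) =
      step (valueSet Format.E2M1) z f :=
    fun z => (doubleSR_named_iff (by decide) (by decide)).mpr (by decide) z f
  simp only [h1]
  exact (doubleSR_named_iff (by decide) (by decide)).mpr (by decide) c f

/-- Example, NOT innocuous: E3M2 via E2M3 (`1/16 ∈ F_E3M2 ∖ F_E2M3`): some input and test
function distinguish double from single SR. -/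
theorem doubleSR_E3M2_via_E2M3 :
    ¬ ∀ (c : ℚ) (f : ℚ → ℚ), step (valueSet Format.E2M3) c
        (fun y => step (valueSet Format.E3M2) y f) = step (valueSet Format.E3M2) c f :=
  fun h => absurd ((doubleSR_named_iff (by decide) (by decide)).mp h) (by decide)

/-- … with the kernel's explicit witness on the literal FP6 tables: at `c = 1/16` single SR into
E3M2 is exact (variance `0`), while SR into E2M3 first sends `1/16` to `0` or `1/8` with
probability `1/2` each, both E3M2 values: the composite has variance `1/256` and puts mass `1/2`
on `0`. -/
theorem doubleSR_E3M2_via_E2M3_witness :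
    step Formats.e3m2 (1 / 16 : ℚ) (fun z => (z - 1 / 16) ^ 2) = 0 ∧
    step Formats.e2m3 (1 / 16 : ℚ) (fun y => step Formats.e3m2 y fun z => (z - 1 / 16) ^ 2)
      = 1 / 256 ∧
    step Formats.e2m3 (1 / 16 : ℚ) (fun y => step Formats.e3m2 y fun z => if z = 0 then 1 else 0)
      = 1 / 2 := by
  refine ⟨by decide +kernel, by decide +kernel, by decide +kernel⟩


end Summit.Ventures.CertifiedArithmetic.LowPrec.SR
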